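import Summits.HubbardSuperconductivity.HubbardLadder.PairSourceEnergyCeilingAlong
import Summits.HubbardSuperconductivity.HubbardLadder.Bounds.LUCUpperBoundsTI
import Literature.MathematicalPhysics.QuantumLattice.HubbardRectangularTorus
import Literature.MathematicalPhysics.QuantumLattice.HubbardRingPerronFrobeniusProofs
import Literature.MathematicalPhysics.QuantumLattice.HubbardTorusLocalCertificate
import HarnessLib

/-!
# Hubbard ladder — route #2 (sourced energy response): the two ENERGY ROWS, bridged

HONEST FRAMING (cell pub-hubbard): ladder R1–R4 with certified numbers; no claim on `H`/`H₀`.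
This file certifies NO number and runs nothing. It closes the two bookkeeping steps that
`PairSourceEnergyCeilingAlong.lean` (§"Producer status") lists as missing between the cell's
torus-family energy UPPER node `Bounds.luctiUpper_16k_U8_N224kk_ti4ds` (`U = 8`, `t′ = 0`,
`N = 224k²` electrons on the `16k × 16k` torus, i.e. `n̄ = 7/8`) and the `hup` input of
`PairSourceEnergyCertAlong.ofEnergyRows`: the reindexing `fermionRectTorusGraph L L ≅
fermionTorusGraph 2 L` (Literature `groundEnergyAt_fermionTorusGraph_two`) and the `S^z = 0`
refinement of an all-sector ground-energy bound (every `SU(2)` multiplet meets `S^z = 0`; Literature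
`groundEnergyAt_eq_minEnergyOn_szSector`, Lieb 1989). With both, input (a) of route #2 along
`16 ∣ L` IS the node, and the chain is typable today modulo exactly ONE missing input, which enters
below as an explicit HYPOTHESIS (never a node, never a fact): a translation-invariant LOWER bound
`∃ L₀, ∀ L ≥ L₀, eL·L² ≤ E₀(A_L)` on the ground-state energy of the grand-canonical d-wave PAIR-SOURCED
model `A_L = H_L(1,8) − μN_L − h(Δ_L + Δ_Lᴴ)` (`dWaveSourceTorus L 8 μ h`) — the conclusion shape of
the Literature soundness theorems `dWaveSourceTorus_groundEnergy_ge_of_window_certificate[_d4]_eventually`;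
NO instance is known, none is claimed, no producer exists (engines REQUESTS L934/L978, R-259(b)).

## Contents (all sorry-free)
* `minEnergyOn_szSector_le_of_luctiUpper` — input (a) in the `hup` shape:
  `luctiUpper_16k_U8_N224kk_ti4ds ⇒ λ_min(H_L(1,8) | N = electronNumber (1/8) L, S^z = 0)
  ≤ (−369071688991/2³⁹)·L²` for every side `L ≠ 0` with `16 ∣ L`.
* `exists_pairSourceEnergyCertAlong_of_luctiUpper` — (a) ∧ (b) ∧ `s := −369071688991/2³⁹ − (7/8)μ − eL
  > 0` ⇒ a `PairSourceEnergyCertAlong 8 (electronNumber (1/8)) 16` with ceiling `s²/(2h²)`.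
* Typed obligation (house style, PROVED): `PairSourceEnergyRowsEdgeU8Eighth` — (a) ∧ (b) ∧ `s > 0` ⇒
  along every admissible ground-state sequence `liminf_k σ_d²(k) ≤ s²/(2h²)`;
  `pairSourceEnergyRowsEdgeU8Eighth_holds`.
Informativeness (labels, not claims): such a conclusion is new only if `s²/(2h²) < 128/π⁴`
(`limsup_dWaveOrderParamSq_le_kinematic`); design numbers in the R3 seat's `R4-SOURCEROWS-SPEC.md`.

Sources: T. Koma, H. Tasaki, J. Stat. Phys. 76 (1994) 745, §1 and Thm 2.2 (sourced energy response
vs order parameter); E. H. Lieb, PRL 62 (1989) 1201, proof of Thm 1 (`S^z = 0` representatives);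
X. Han, arXiv:2006.06002 (2020) §3 (translation-invariant certificates — the intended producer of (b)).
-/

noncomputable section

namespace Summit.HubbardSuperconductivity.HubbardLadder

open Matrix Filter Literature.Probability.LatticeModels
open Literature.MathematicalPhysics.QuantumLattice
open Summit.HubbardSuperconductivity.HubbardLadder.Bounds (luctiUpper_16k_U8_N224kk_ti4ds)
open scoped ComplexOrder Topology

/-- `electronNumber (1/8) (16k) = 2·(112k²)` (as naturals). [folklore] -/
theorem electronNumber_eighth_sixteen_mul (k : ℕ) : electronNumber (1 / 8) (16 * k) = 2 * (112 * k ^ 2) := by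
  have h := electronNumber_eighth_of_four_dvd (L := 16 * k) ⟨4 * k, by ring⟩
  have h' : ((electronNumber (1 / 8) (16 * k) : ℕ) : ℝ) = ((2 * (112 * k ^ 2) : ℕ) : ℝ) := by
    rw [h]; push_cast; ring
  exact_mod_cast h'

/-- **Input (a) in the `hup` shape.** The torus-family UPPER node `luctiUpper_16k_U8_N224kk_ti4ds`
(`E_{16k×16k}(224k²) ≤ (16k)²·(−369071688991/2³⁹)` at `t = 1`, `t′ = 0`, `U = 8`) bounds the
`(N = electronNumber (1/8) L, S^z = 0)` sector minimum of `hubbardTorus 2 L 1 8` on every side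
`L ≠ 0` with `16 ∣ L`: square torus = `L × L` rectangular torus (`groundEnergyAt_fermionTorusGraph_two`)
and `E₀(2n) = λ_min(n, n)` (`groundEnergyAt_eq_minEnergyOn_szSector`, Lieb 1989).
[cite: LiebPRL1989, proof of Theorem 1] -/
theorem minEnergyOn_szSector_le_of_luctiUpper (ha : luctiUpper_16k_U8_N224kk_ti4ds) (L : ℕ) [NeZero L]
    (hd : 16 ∣ L) :
    (hubbardTorus 2 L 1 8).minEnergyOn (szSector (electronNumber (1 / 8) L) 0) ≤
      (-369071688991 : ℝ) / 2 ^ 39 * (L : ℝ) ^ 2 := by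
  obtain ⟨k, rfl⟩ := hd
  have hk : 1 ≤ k := Nat.one_le_iff_ne_zero.2 fun h0 => NeZero.ne (16 * k) (by simp [h0])
  have h1 := ha k hk
  have h224 : 224 * k ^ 2 = 2 * (112 * k ^ 2) := by ring
  have hn : 112 * k ^ 2 ≤ Fintype.card (FermionTorus 2 (16 * k)) := by
    have hc : Fintype.card (FermionTorus 2 (16 * k)) = (16 * k) ^ 2 := by
      simp [FermionTorus, Fintype.card_lex]
    rw [hc]; nlinarith [hk]
  rw [← groundEnergyAt_fermionTorusGraph_two, h224,
    groundEnergyAt_eq_minEnergyOn_szSector (fermionTorusGraph 2 (16 * k)) 1 8 hn] at h1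
  rw [electronNumber_eighth_sixteen_mul, hubbardTorus]
  exact h1.trans_eq (mul_comm _ _)

/-- **The two energy rows ⇒ a sourced-energy certificate along `16 ∣ L`.** Input (a) = the node
`luctiUpper_16k_U8_N224kk_ti4ds`; input (b) = the HYPOTHESIS `∃ L₀, ∀ L ≥ L₀, eL·L² ≤ E₀(dWaveSourceTorus L 8 μ h)`
(no instance known or claimed; the conclusion shape of `dWaveSourceTorus_groundEnergy_ge_of_window_certificate_eventually`);
positivity of the slack `s = −369071688991/2³⁹ − (7/8)μ − eL`. The certificate's ceiling is
`s²/(2h²)` by construction (`PairSourceEnergyCertAlong.ofEnergyRows`). Nothing is instantiated.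
[cite: KomaTasaki1994, Theorem 2.2] -/
theorem exists_pairSourceEnergyCertAlong_of_luctiUpper (ha : luctiUpper_16k_U8_N224kk_ti4ds)
    {μ h eL : ℝ} (hh : 0 < h) (hs : 0 < (-369071688991 : ℝ) / 2 ^ 39 - μ * (7 / 8) - eL)
    (hb : ∃ L₀ : ℕ, ∀ (L : ℕ) [NeZero L], L₀ ≤ L → eL * (L : ℝ) ^ 2 ≤ (dWaveSourceTorus L 8 μ h).groundEnergy) :
    ∃ c : PairSourceEnergyCertAlong 8 (electronNumber (1 / 8)) 16,
      c.ceiling = ((-369071688991 : ℝ) / 2 ^ 39 - μ * (7 / 8) - eL) ^ 2 / (2 * h ^ 2) := by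
  obtain ⟨L₁, hL₁⟩ := hb
  exact ⟨PairSourceEnergyCertAlong.ofEnergyRows (U := 8) (N := electronNumber (1 / 8)) (d := 16) h hh μ
      ((-369071688991 : ℝ) / 2 ^ 39) eL (7 / 8) L₁ hs
      (fun L _ hdL => electronNumber_eighth_of_four_dvd (dvd_trans ⟨4, by norm_num⟩ hdL))
      (fun L _ _ hdL => minEnergyOn_szSector_le_of_luctiUpper ha L hdL)
      (fun L _ hL _ => hL₁ L hL), rfl⟩

/-! ### Typed obligation (the cell's house style: `@[conjecture] def` + `_holds`) -/

/-- **Typed EDGE of route #2 (PROVED below; an implication, not a claim about either row)**: the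
torus-family upper node `luctiUpper_16k_U8_N224kk_ti4ds` AND a grand-canonical pair-sourced lower
bound `eL·L² ≤ E₀(dWaveSourceTorus L 8 μ h)` for all large `L` (HYPOTHESIS; no instance known) with
positive slack `s = −369071688991/2³⁹ − (7/8)μ − eL` imply, along every admissible sequence of
normalised `S^z = 0` sector ground states at `U = 8`, `δ = 1/8`, `liminf_k σ_d²(k) ≤ s²/(2h²)`.
New as a statement only when `s²/(2h²) < 128/π⁴` (`limsup_dWaveOrderParamSq_le_kinematic`).
HONEST FRAMING: ladder R1–R4 with certified numbers; no claim on `H`/`H₀`; nothing instantiated.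
[cite: KomaTasaki1994, Theorem 2.2] [cite: TasakiWatanabe2021, discussion after eq. (11)] -/
@[conjecture] def PairSourceEnergyRowsEdgeU8Eighth : Prop :=
  luctiUpper_16k_U8_N224kk_ti4ds →
    ∀ (μ h eL : ℝ), 0 < h → 0 < (-369071688991 : ℝ) / 2 ^ 39 - μ * (7 / 8) - eL →
      (∃ L₀ : ℕ, ∀ (L : ℕ) [NeZero L], L₀ ≤ L → eL * (L : ℝ) ^ 2 ≤ (dWaveSourceTorus L 8 μ h).groundEnergy) →
        ∀ (N : ℕ → ℕ) (ψ : ∀ L, Fock (Orb (FermionTorus 2 L))),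
          (∀ L, Even L → N L = 2 * ⌊(1 - 1 / 8) * (L : ℝ) ^ 2 / 2⌋₊ ∧ star (ψ L) ⬝ᵥ ψ L = 1 ∧
              IsGroundStateInSector (hubbardTorus 2 L 1 8) (N L) 0 (ψ L)) →
            liminf (fun k => dWaveOrderParamSq ψ k) atTop ≤
              ((-369071688991 : ℝ) / 2 ^ 39 - μ * (7 / 8) - eL) ^ 2 / (2 * h ^ 2)

/-- **Proof of `PairSourceEnergyRowsEdgeU8Eighth`** (`exists_pairSourceEnergyCertAlong_of_luctiUpper` +
`liminf_dWaveOrderParamSq_le_of_pairSourceEnergyCertAlong` along `d = 16`). -/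
theorem pairSourceEnergyRowsEdgeU8Eighth_holds : PairSourceEnergyRowsEdgeU8Eighth := by
  intro ha μ h eL hh hs hb N ψ hNψ
  obtain ⟨c, hc⟩ := exists_pairSourceEnergyCertAlong_of_luctiUpper ha hh hs hb
  rw [← hc]
  exact liminf_dWaveOrderParamSq_le_of_pairSourceEnergyCertAlong (d := 16) (by norm_num) ⟨8, by norm_num⟩
    c N ψ hNψ

end Summit.HubbardSuperconductivity.HubbardLadder
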